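import Summits.CriticalPhenomena.PercolationContinuityZ3.Theorems.PercNearOneGluingNearOneGluingKnLemma3i
import HarnessLib

/-!
# `NoHeavyLowerTail` (stmt-CriticalPhenomena-4575) — SET-GAIN, proved half: gluing a vertex set `S` helps every member
# `g ∈ S` at least as much as any outsider `x` that was at least as `b`-reliable as `g`

Support file (lemma factory `prim-lf-2`, deletion–contraction, gen 12; `--supports stmt-CriticalPhenomena-4575`).  No
definitions, no named facts, no sorries.  Memo: `run/shared/lean/prim/prim-lf-2/FINAL-prim-lf-2.md` §6.

SETTING.  Bond percolation `μ = prodBernoulli w` with arbitrary pair probabilities on `Fin n`; a target `b`, a finite vertex set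
`S`, a member `g ∈ S` and a vertex `x`.  Gluing `S` (all pairs inside `S` made sure) turns `{u ↔ b}` into
`{u ↔ b} ∪ ({u ↔ S} ∩ {S ↔ b})`, so the GAIN of `u` from gluing `S` is `μ(u ↮ b, u ↔ S, S ↔ b)` ("`u` hangs on a dead member of
`S` while another member reaches `b`"), and the gain of a member `g` is `μ(S ↔ b) − μ(g ↔ b)`.  prim-hp-1 (gen 14, HULLPORT-COUPLING
§53, 'SET-GAIN') asks whether the WEAKEST member `g_w` of `S` gains at least as much as every outsider:
`gain_x(S) ≤ gain_{g_w}(S)`; `|S| = 2` is prim-lf-3's `UpsetExchange.pairGlue_gain_le`.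

* `SetGlueGain.parasite_add_member_le` — **for every member `g ∈ S` and every `x` with `μ(g ↔ b) ≤ μ(x ↔ b)`:**
  `μ(x ↮ b, x ↔ S, S ↔ b) + μ(g ↔ b) ≤ μ(S ↔ b)`, i.e. `gain_x(S) ≤ gain_g(S)`.
  Three lines: `μ(g↔b) = μ(g↔b, x↔S) + μ(g↔b, x↮S)`; the first term is `≤ μ(x↔b, x↔S)` by Kozma–Nitzan's Lemma 3(i)
  (`knLemma3i`, the event `{x ↔ S}` is increasing in the open edge cluster of `x`), the second is `≤ μ(S↔b, x↮S)` because
  `g ∈ S`; and `{x↔b, x↔S}`, `{S↔b, x↮S}`, `{x↮b, x↔S, S↔b}` are disjoint parts of `{S ↔ b}`.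
  Consequently SET-GAIN holds for every outsider at least as reliable as the weakest member (and trivially for members); what
  remains of hp-1's question is exactly the case of an outsider STRICTLY LESS reliable than every member of `S` (census: 0
  violations, memo §6).
[cite: KozmaNitzan2024, Lemma 3(i) (p. 6); VandenbergHaggstromKahn2005, Thm. 1.3]
-/

namespace Summit.CriticalPhenomena.PercolationContinuityZ3.Theorems

open MeasureTheory Set
open Literature.Probability.LatticeModels
open Literature.Probability.Percolation

noncomputable section
open Classical

namespace SetGlueGain

variable {n : ℕ}

/-- `{x ↔ S} := ⋃_{s ∈ S} {x ↔ s}` is increasing in the open edge cluster of `x`. [folklore] -/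
theorem reachSet_mono_openEdgeCluster (S : Finset (Fin n)) (x : Fin n) (ω ω' : BondConfig (Fin n))
    (hω : ω ∈ ⋃ s ∈ S, openConn x s) (hsub : openEdgeCluster ω x ⊆ openEdgeCluster ω' x) :
    ω' ∈ ⋃ s ∈ S, openConn x s := by
  simp only [mem_iUnion, exists_prop] at hω ⊢
  obtain ⟨s, hs, hxs⟩ := hω
  refine ⟨s, hs, ?_⟩
  have h : (openGraph ω).Reachable x s := hxs
  have h' : (openGraph ω').Reachable x s := by
    rw [reachable_iff_exists_mem_openEdgeCluster] at h ⊢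
    rcases h with h | ⟨e, he, hse⟩
    · exact Or.inl h
    · exact Or.inr ⟨e, hsub he, hse⟩
  exact h'

/-- **SET-GAIN for a member versus a more reliable outsider.**  `S` a finite vertex set, `g ∈ S`, `x` any vertex with
`μ(g ↔ b) ≤ μ(x ↔ b)`.  Then `μ(x ↮ b, x ↔ S, S ↔ b) + μ(g ↔ b) ≤ μ(S ↔ b)`: the gain of `x` from gluing `S`
(`= μ(x ↮ b, x ↔ S, S ↔ b)`) is at most the gain of the member `g` (`= μ(S ↔ b) − μ(g ↔ b)`).
[cite: KozmaNitzan2024, Lemma 3(i) (p. 6); VandenbergHaggstromKahn2005, Thm. 1.3] -/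
theorem parasite_add_member_le (w : Sym2 (Fin n) → unitInterval) (S : Finset (Fin n)) (g x b : Fin n) (hg : g ∈ S)
    (hrow : (prodBernoulli w).real (openConn g b) ≤ (prodBernoulli w).real (openConn x b)) :
    (prodBernoulli w).real ((openConn x b)ᶜ ∩ (⋃ s ∈ S, openConn x s) ∩ (⋃ s ∈ S, openConn s b)) +
        (prodBernoulli w).real (openConn g b) ≤
      (prodBernoulli w).real (⋃ s ∈ S, openConn s b) := by
  have hmeas : ∀ X : Set (BondConfig (Fin n)), MeasurableSet X := fun _ => MeasurableSet.of_discrete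
  set μ := prodBernoulli w with hμ
  set A : Set (BondConfig (Fin n)) := ⋃ s ∈ S, openConn x s with hA
  set U : Set (BondConfig (Fin n)) := ⋃ s ∈ S, openConn s b with hU
  set X : Set (BondConfig (Fin n)) := openConn x b with hX
  set G : Set (BondConfig (Fin n)) := openConn g b with hG
  -- Step 1 (KN Lemma 3(i)): `μ(G ∩ A) ≤ μ(X ∩ A)`
  have h1 : μ.real (G ∩ A) ≤ μ.real (X ∩ A) := by
    have key := knLemma3i n w g x b A 0 (fun ω ω' hω hsub => reachSet_mono_openEdgeCluster S x ω ω' hω hsub)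
      le_rfl (by rw [add_zero]; exact hrow)
    simpa only [zero_mul, add_zero] using key
  -- Step 2: `G \ A ⊆ U \ A` (the member `g` reaching `b` is part of `S ↔ b`)
  have hGU : G ⊆ U := by
    intro ω hω
    simp only [hU, mem_iUnion, exists_prop]
    exact ⟨g, hg, hω⟩
  have h2 : μ.real (G \ A) ≤ μ.real (U \ A) := measureReal_mono (fun ω hω => ⟨hGU hω.1, hω.2⟩)
  -- Step 3: `X ∩ A ⊆ U` (if `x ↔ b` and `x ↔ s` then `s ↔ b`)
  have hXAU : X ∩ A ⊆ U ∩ A := by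
    rintro ω ⟨hxb, hxa⟩
    refine ⟨?_, hxa⟩
    simp only [hA, mem_iUnion, exists_prop] at hxa
    obtain ⟨s, hs, hxs⟩ := hxa
    simp only [hU, mem_iUnion, exists_prop]
    refine ⟨s, hs, ?_⟩
    have h1' : (openGraph ω).Reachable x b := hxb
    have h2' : (openGraph ω).Reachable x s := hxs
    exact h2'.symm.trans h1'
  -- bookkeeping: `μ G = μ(G ∩ A) + μ(G \ A)`, `μ U = μ(U ∩ A ∩ X) + μ((U ∩ A) \ X) + μ(U \ A)`
  have eG : μ.real (G ∩ A) + μ.real (G \ A) = μ.real G :=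
    measureReal_inter_add_sdiff (μ := μ) (s := G) (hmeas A) (measure_ne_top _ _)
  have eU : μ.real (U ∩ A) + μ.real (U \ A) = μ.real U :=
    measureReal_inter_add_sdiff (μ := μ) (s := U) (hmeas A) (measure_ne_top _ _)
  have eUA : μ.real (U ∩ A ∩ X) + μ.real ((U ∩ A) \ X) = μ.real (U ∩ A) :=
    measureReal_inter_add_sdiff (μ := μ) (s := U ∩ A) (hmeas X) (measure_ne_top _ _)
  have e3 : μ.real (X ∩ A) ≤ μ.real (U ∩ A ∩ X) :=
    measureReal_mono (fun ω hω => ⟨hXAU hω, hω.1⟩)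
  have e4 : Xᶜ ∩ A ∩ U = (U ∩ A) \ X := by
    ext ω; simp only [mem_inter_iff, mem_compl_iff, mem_sdiff]; tauto
  rw [e4]
  linarith [h1, h2, eG, eU, eUA, e3]

end SetGlueGain

end

end Summit.CriticalPhenomena.PercolationContinuityZ3.Theorems
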